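import Summits.QuantumFields.BalabanUV.Beta.GAN24.TaylorTrilinearCarry
import Summits.QuantumFields.BalabanUV.Beta.GAN24.TaylorTrilinearDiffSlices

/-!
# `BalabanUV.Beta.GAN24.TaylorTrilinearTransport` — binder row G-an2-4 ∕ (CONV-C), S-slot, road «S3-Taylor», DIFF row R3-dW:
# generic leaf, PART 5 of 7 — THE TRANSPORTED SLICE OVER ONE CELL READS THE CARRY TABLE; Hermite kills the linear part;
# the remainder groups and the mixed group

G-an2-4 formalisation swarm, leaf prover 15 (unit `b2b-balaban-gan24-formalise-leaf-15`, gen 14; DIFF row R3-dW holder, INTENT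
CLAIMS.log l.4908).  HONEST FRAMING (cell rule, verbatim): «discharging `BetaPertH` makes Bałaban's UV stability UNCONDITIONAL — a
real constructive-QFT result; it is NOT the continuum limit and NOT the Clay problem.»  HONEST DEPENDENCY (verbatim): «continuum YM
on T⁴ ⇐ BetaPertH ∧ nine spine estimates (0/9 proved); BetaPertH ⇐ (D1) ∧ (D4) ∧ CAP+tail; G-an2-4 gates asym, D1 and NE2/3/4.»
NOT IN PRINT; OUR BOOKKEEPING ([folklore]): elementary real analysis ∕ finite algebra on `ℤ^{d+1}`, GENERIC `d`, GENERIC blockings,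
ABSTRACT legs and table; NO object of an2's typed `U = 1` system occurs, nothing is cited, no `def … : Prop`, NOTHING is asserted
or discharged of «E3Shape»∕«E3SupRate» (OPEN, not in print), of (hS, hSall), of the K-slot, of `BetaPertH`.
NOT BetaPertH, NOT continuum, NOT Clay.

CONTEXT (asserted nowhere below).  The RATE table of the S-slot (`GAN24/StencilSlotE3RateOfPieces.e3SupRate_of_pieces`,
row owner gan24-p1) has the DIFFERENCE row R3-dW: the Wilson piece of the normalised third jet at member `n+3` (blocking
`N′ = N·Lc`) minus the one at member `n+2` (blocking `N`), `≤ cW·θ^{n+1}`.  By `E3UnitSplit.e3W_unit_split` both are (at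
`d = 3`, residual `1`) the SAME unit sandwich functional — three legs, one block average, ONE explicit factor of the blocking
on the SAME translation-invariant zero-row-sum table `wilsonA` — read at two blockings.  This chain of generic leaves
(`TaylorTrilinearCarry` ∕ `…Pairing` ∕ `…DiffSlices` ∕ `…DiffSummed` ∕ `…Transport` ∕ `…TransportBound` ∕ `…Diff`) proves the
two-level difference bound `TaylorTrilinearDiff.trilinear_diff_bound`: TRANSPORT the level-`N` legs to the finer lattice by
`quo Lc` (piecewise constant on cells), split trilinearly — the couplings «(N1-Cauchy)» enter BY THEIR SUP ONLY thanks to ONE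
ABEL SUMMATION in the vertex location — and compare the transported functional with the original one EXACTLY through the
CARRY TABLE of a cell (Hermite's identity: same row sum, same first moments ⇒ second order ⇒ `O(1/N)` by the pairing lemma).

## What is proved ([folklore], `0 sorry`)
* §1 `slice_tinv`, **`slice_transport_cell`** (at `u = L•v + r` the transported slice reads `G (v + quo L (r+s))`, `K (v + quo L (r+t))`),
  `expand_pair` (pure algebra: `λΣ_r g(v+cs)k(v+ct) − g(v+s)k(v+t)` = `gk(λ#box−1)` + two one-leg groups + mixed), **`hermite_rem2`**
  (`λ·L^d = 1` ⇒ the one-leg group is `λΣ_r rem2 k (ct r) − rem2 k t`: the LINEAR PART CANCELS by `TaylorTrilinearCarry.sum_box_quo_toSite_add`).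
* §2 `sum_box_comm`, **`cell_discrepancy_eq`** (zero row sum + Hermite: `Σ_r slicê(L•v+r) − slice v` = `K`-remainder group +
  `G`-remainder group + mixed group, exactly), `tsum_sum5`, `summable_group_term`, **`abs_tsum_group_le`** (a remainder group is
  `|B|²(d+1)³·c·C_T·(L+1)·R·α_A·β_F·S₃` by the PAIRING LEMMA per family, carries no longer than offsets, `λ·#box = L`),
  `abs_mixed_le` (the mixed group pointwise: two box steps, `O(R²/N²)`).
-/

noncomputable section

open Finset
open scoped BigOperators
open Literature.MathematicalPhysics.QuantumFieldTheory Balaban1983to89 Balaban1983to89.Beta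
open B12Sec2to5 (l1 l1_nonneg)
open ExpKernelCalculus (Zl l1_sub_triangle l1_sub_symm)
open LatticeForm (quo)
open KKTFluctuationEnergy (tsum_blocks quo_zsmul_add_toSite)
open AffineAveraging (box toSite)

namespace Summit.QuantumFields.BalabanUV.Beta.GAN24.TaylorTrilinearTransport

open Summit.QuantumFields.BalabanUV.Beta.GAN24.TaylorTrilinearLattice
open Summit.QuantumFields.BalabanUV.Beta.GAN24.TaylorTrilinear (nonneg_of_abs_le_mul_exp abs_le_of_abs_le_mul_exp)
open Summit.QuantumFields.BalabanUV.Beta.GAN24.TaylorTrilinearCarry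
open Summit.QuantumFields.BalabanUV.Beta.GAN24.TaylorTrilinearPairing
open Summit.QuantumFields.BalabanUV.Beta.GAN24.TaylorTrilinearDiffSlices

variable {d : ℕ}

/-! ## §1 The transported slice over one cell: carries; the level-`N` slice; the algebraic second-order expansion -/

section Identities

variable (L : ℕ) [NeZero L] (c ν : ℝ) (G K H : Fin (d + 1) → (Fin (d + 1) → ℤ) → ℝ)
  (T : Fin (d + 1) → (Fin (d + 1) → ℤ) → (Fin (d + 1) → ℤ) → (Fin (d + 1) → ℤ) → Fin (d + 1) → Fin (d + 1) → ℝ)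
  (B : Finset (Fin (d + 1) → ℤ))

/-- [folklore] A translation-invariant table makes the slice read `T κ 0 s t`. -/
theorem slice_tinv (hTinv : ∀ κ v s t l l', T κ v (v + s) (v + t) l l' = T κ 0 s t l l') (v : Fin (d + 1) → ℤ) :
    slice c ν G K H T B v = ∑ t ∈ B, ∑ s ∈ B, ∑ l' : Fin (d + 1), ∑ l : Fin (d + 1), ∑ κ : Fin (d + 1),
      c * ν * (G l (v + s) * H κ v * T κ 0 s t l l' * K l' (v + t)) := by
  unfold TaylorTrilinearDiffSlices.slice
  exact Finset.sum_congr rfl fun t _ => Finset.sum_congr rfl fun s _ => Finset.sum_congr rfl fun l' _ =>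
    Finset.sum_congr rfl fun l _ => Finset.sum_congr rfl fun κ _ => by rw [hTinv]

/-- [folklore] **THE TRANSPORTED SLICE AT A CELL POINT READS THE CARRIES**: for the legs `Ĝ := G ∘ quo L` etc. and a cell
point `u = L•v + r`, `r ∈ [0,L)^{d+1}`: `slice c ν Ĝ K̂ Ĥ T B u = Σ c ν G l (v + quo L (r+s))·H κ v·T κ 0 s t·K l′ (v + quo L (r+t))`. -/
theorem slice_transport_cell (hTinv : ∀ κ v s t l l', T κ v (v + s) (v + t) l l' = T κ 0 s t l l')
    (v : Fin (d + 1) → ℤ) {r : Fin (d + 1) → ℕ} (hr : r ∈ box (d + 1) L) :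
    slice c ν (fun l w => G l (quo L w)) (fun l' y => K l' (quo L y)) (fun κ u => H κ (quo L u)) T B
        ((L : ℤ) • v + toSite r) =
      ∑ t ∈ B, ∑ s ∈ B, ∑ l' : Fin (d + 1), ∑ l : Fin (d + 1), ∑ κ : Fin (d + 1),
        c * ν * (G l (v + quo L (toSite r + s)) * H κ v * T κ 0 s t l l' * K l' (v + quo L (toSite r + t))) := by
  rw [slice_tinv c ν _ _ _ T B hTinv]
  refine Finset.sum_congr rfl fun t _ => Finset.sum_congr rfl fun s _ => Finset.sum_congr rfl fun l' _ =>
    Finset.sum_congr rfl fun l _ => Finset.sum_congr rfl fun κ _ => ?_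
  simp only [quo_cell_add, quo_zsmul_add_toSite v hr]

variable {L}

/-- [folklore] **THE SECOND-ORDER EXPANSION, ONE PAIR OF TABLE LEGS** (pure algebra): with `dg a := g (v+a) − g v`,
`λ·Σ_r g(v + cs r)·k(v + ct r) − g(v+s)·k(v+t) = g v·k v·(λ·#box − 1) + g v·(λΣ_r dk(ct r) − dk t) + k v·(λΣ_r dg(cs r) − dg s)
  + (λΣ_r dg(cs r)·dk(ct r) − dg s·dk t)`. -/
theorem expand_pair (lam : ℝ) (g k : (Fin (d + 1) → ℤ) → ℝ) (box' : Finset (Fin (d + 1) → ℕ))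
    (cs ct : (Fin (d + 1) → ℕ) → Fin (d + 1) → ℤ) (s t v : Fin (d + 1) → ℤ) :
    lam * (∑ r ∈ box', g (v + cs r) * k (v + ct r)) - g (v + s) * k (v + t) =
      g v * k v * (lam * box'.card - 1) +
      g v * (lam * (∑ r ∈ box', (k (v + ct r) - k v)) - (k (v + t) - k v)) +
      k v * (lam * (∑ r ∈ box', (g (v + cs r) - g v)) - (g (v + s) - g v)) +
      (lam * (∑ r ∈ box', (g (v + cs r) - g v) * (k (v + ct r) - k v)) - (g (v + s) - g v) * (k (v + t) - k v)) := by
  have h : ∀ r, g (v + cs r) * k (v + ct r) = g v * k v + g v * (k (v + ct r) - k v) + k v * (g (v + cs r) - g v) +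
      (g (v + cs r) - g v) * (k (v + ct r) - k v) := fun r => by ring
  simp only [h, Finset.sum_add_distrib, Finset.sum_const, nsmul_eq_mul, ← Finset.mul_sum]
  ring

/-- [folklore] **HERMITE KILLS THE LINEAR PART**: with `λ·L^d = 1` and the carries `ct r := quo L (r + t)` of one cell,
`λΣ_r (k(v + ct r) − k v) − (k(v+t) − k v) = λΣ_r rem2 k (ct r) v − rem2 k t v` (`sum_box_quo_toSite_add`). -/
theorem hermite_rem2 {lam : ℝ} (hlam : lam * (L : ℝ) ^ d = 1) (k : (Fin (d + 1) → ℤ) → ℝ)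
    (t v : Fin (d + 1) → ℤ) :
    lam * (∑ r ∈ box (d + 1) L, (k (v + quo L (toSite r + t)) - k v)) - (k (v + t) - k v) =
      lam * (∑ r ∈ box (d + 1) L, rem2 k (quo L (toSite r + t)) v) - rem2 k t v := by
  have hlin : lam * ∑ r ∈ box (d + 1) L, ∑ j, (quo L (toSite r + t) j : ℝ) * (k (v + Pi.single j 1) - k v) =
      ∑ j, (t j : ℝ) * (k (v + Pi.single j 1) - k v) := by
    rw [Finset.sum_comm, Finset.mul_sum]
    refine Finset.sum_congr rfl fun j _ => ?_
    rw [← Finset.sum_mul, ← mul_assoc]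
    congr 1
    have h := sum_box_quo_toSite_add L t j
    have h' : (∑ r ∈ box (d + 1) L, (quo L (toSite r + t) j : ℝ)) = (L : ℝ) ^ d * t j := by exact_mod_cast h
    rw [h', ← mul_assoc, hlam, one_mul]
  have hrem : ∀ b, k (v + b) - k v = rem2 k b v + ∑ j, (b j : ℝ) * (k (v + Pi.single j 1) - k v) := fun b => by
    unfold rem2; ring
  rw [Finset.sum_congr rfl fun r _ => hrem (quo L (toSite r + t)), hrem t, Finset.sum_add_distrib, mul_add, hlin]
  ring

end Identities

/-! ## §2 The transported-versus-original discrepancy `(II)`, summed over the vertex location: `O(1/N)` -/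

/-- [folklore] Six finite sums: the cell sum moves innermost. -/
theorem sum_box_comm {ι : Type*} (A : Finset ι) (B : Finset (Fin (d + 1) → ℤ))
    (f : ι → (Fin (d + 1) → ℤ) → (Fin (d + 1) → ℤ) → Fin (d + 1) → Fin (d + 1) → Fin (d + 1) → ℝ) :
    ∑ r ∈ A, ∑ t ∈ B, ∑ s ∈ B, ∑ l' : Fin (d + 1), ∑ l : Fin (d + 1), ∑ κ : Fin (d + 1), f r t s l' l κ =
      ∑ t ∈ B, ∑ s ∈ B, ∑ l' : Fin (d + 1), ∑ l : Fin (d + 1), ∑ κ : Fin (d + 1), ∑ r ∈ A, f r t s l' l κ := by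
  rw [Finset.sum_comm]; refine Finset.sum_congr rfl fun t _ => ?_
  rw [Finset.sum_comm]; refine Finset.sum_congr rfl fun s _ => ?_
  rw [Finset.sum_comm]; refine Finset.sum_congr rfl fun l' _ => ?_
  rw [Finset.sum_comm]; refine Finset.sum_congr rfl fun l _ => ?_
  rw [Finset.sum_comm]

section Bound

variable (N L N' : ℕ) [NeZero N] [NeZero L] [NeZero N'] (G K H : Fin (d + 1) → (Fin (d + 1) → ℤ) → ℝ)
  (T : Fin (d + 1) → (Fin (d + 1) → ℤ) → (Fin (d + 1) → ℤ) → (Fin (d + 1) → ℤ) → Fin (d + 1) → Fin (d + 1) → ℝ)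
  (B : Finset (Fin (d + 1) → ℤ)) (x' z' u' : Fin (d + 1) → ℤ) {δ CG CG' CK CK' CH CH' CT : ℝ} {R : ℕ}

/-- [folklore] THE DISCREPANCY AT ONE COARSE POINT, EXPANDED (zero row sum + Hermite): for every `v`,
`Σ_r slice c₁ ν₁ Ĝ K̂ Ĥ (L•v + r) − slice c ν G K H v`, with `c₁ν₁ = λ·(cν)`, `λ = L^{−d}`, equals
`Σ c ν T₀ H v·[G v·(λΣ_r rem2 K (ct r) − rem2 K t) + K v·(λΣ_r rem2 G (cs r) − rem2 G s) + mixed]`. -/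
theorem cell_discrepancy_eq (c ν lam : ℝ) (hlam : lam * (L : ℝ) ^ d = 1)
    (hTsum : ∀ κ v l l', ∑ s ∈ B, ∑ t ∈ B, T κ v (v + s) (v + t) l l' = 0)
    (hTinv : ∀ κ v s t l l', T κ v (v + s) (v + t) l l' = T κ 0 s t l l') (v : Fin (d + 1) → ℤ) :
    (∑ r ∈ box (d + 1) L, slice (lam * c) ν (fun l w => G l (quo L w)) (fun l' y => K l' (quo L y))
        (fun κ u => H κ (quo L u)) T B ((L : ℤ) • v + toSite r)) - slice c ν G K H T B v =
      ∑ t ∈ B, ∑ s ∈ B, ∑ l' : Fin (d + 1), ∑ l : Fin (d + 1), ∑ κ : Fin (d + 1),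
        c * ν * (H κ v * T κ 0 s t l l') *
          (G l v * (lam * (∑ r ∈ box (d + 1) L, rem2 (K l') (quo L (toSite r + t)) v) - rem2 (K l') t v) +
           K l' v * (lam * (∑ r ∈ box (d + 1) L, rem2 (G l) (quo L (toSite r + s)) v) - rem2 (G l) s v) +
           (lam * (∑ r ∈ box (d + 1) L, (G l (v + quo L (toSite r + s)) - G l v) *
              (K l' (v + quo L (toSite r + t)) - K l' v)) - (G l (v + s) - G l v) * (K l' (v + t) - K l' v))) := by
  rw [Finset.sum_congr rfl fun r hr => slice_transport_cell L (lam * c) ν G K H T B hTinv v hr, sum_box_comm,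
    slice_tinv c ν G K H T B hTinv v]
  simp only [← Finset.sum_sub_distrib]
  -- the `G v·K v·(λ·#box − 1)` terms vanish by the zero row sum (they do not depend on `(s, t)` except through `T₀`)
  have hZ : ∑ t ∈ B, ∑ s ∈ B, ∑ l' : Fin (d + 1), ∑ l : Fin (d + 1), ∑ κ : Fin (d + 1),
      c * ν * (H κ v * T κ 0 s t l l') * (G l v * K l' v * (lam * (box (d + 1) L).card - 1)) = 0 := by
    simp only [Finset.sum_comm (s := B) (t := (Finset.univ : Finset (Fin (d + 1))))]
    refine Finset.sum_eq_zero fun l' _ => Finset.sum_eq_zero fun l _ => Finset.sum_eq_zero fun κ _ => ?_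
    have h0 : ∑ t ∈ B, ∑ s ∈ B, T κ 0 s t l l' = 0 := by
      have h := hTsum κ 0 l l'; simp only [zero_add] at h; rw [Finset.sum_comm]; exact h
    calc ∑ t ∈ B, ∑ s ∈ B, c * ν * (H κ v * T κ 0 s t l l') * (G l v * K l' v * (lam * (box (d + 1) L).card - 1))
        = (c * ν * H κ v * (G l v * K l' v * (lam * (box (d + 1) L).card - 1))) * ∑ t ∈ B, ∑ s ∈ B, T κ 0 s t l l' := by
          rw [Finset.mul_sum]; refine Finset.sum_congr rfl fun t _ => ?_
          rw [Finset.mul_sum]; exact Finset.sum_congr rfl fun s _ => by ring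
      _ = 0 := by rw [h0, mul_zero]
  -- termwise expansion (with the vanishing group carried along), then drop it by `hZ`
  have hterm : ∀ t ∈ B, ∀ s ∈ B, ∀ (l' l κ : Fin (d + 1)),
      (∑ r ∈ box (d + 1) L, lam * c * ν * (G l (v + quo L (toSite r + s)) * H κ v * T κ 0 s t l l' *
        K l' (v + quo L (toSite r + t)))) - c * ν * (G l (v + s) * H κ v * T κ 0 s t l l' * K l' (v + t)) =
      c * ν * (H κ v * T κ 0 s t l l') *
          (G l v * (lam * (∑ r ∈ box (d + 1) L, rem2 (K l') (quo L (toSite r + t)) v) - rem2 (K l') t v) +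
           K l' v * (lam * (∑ r ∈ box (d + 1) L, rem2 (G l) (quo L (toSite r + s)) v) - rem2 (G l) s v) +
           (lam * (∑ r ∈ box (d + 1) L, (G l (v + quo L (toSite r + s)) - G l v) *
              (K l' (v + quo L (toSite r + t)) - K l' v)) - (G l (v + s) - G l v) * (K l' (v + t) - K l' v))) +
        c * ν * (H κ v * T κ 0 s t l l') * (G l v * K l' v * (lam * (box (d + 1) L).card - 1)) := by
    intro t _ s _ l' l κ
    have hpair := expand_pair lam (G l) (K l') (box (d + 1) L) (fun r => quo L (toSite r + s))
      (fun r => quo L (toSite r + t)) s t v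
    have hK := hermite_rem2 (L := L) hlam (K l') t v
    have hG := hermite_rem2 (L := L) hlam (G l) s v
    have e1 : (∑ r ∈ box (d + 1) L, lam * c * ν * (G l (v + quo L (toSite r + s)) * H κ v * T κ 0 s t l l' *
        K l' (v + quo L (toSite r + t)))) - c * ν * (G l (v + s) * H κ v * T κ 0 s t l l' * K l' (v + t)) =
        c * ν * (H κ v * T κ 0 s t l l') * (lam * (∑ r ∈ box (d + 1) L, G l (v + quo L (toSite r + s)) *
          K l' (v + quo L (toSite r + t))) - G l (v + s) * K l' (v + t)) := by
      rw [mul_sub, Finset.mul_sum, Finset.mul_sum]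
      congr 1
      · exact Finset.sum_congr rfl fun r _ => by ring
      · ring
    rw [e1, hpair, ← hK, ← hG]
    ring
  calc ∑ t ∈ B, ∑ s ∈ B, ∑ l' : Fin (d + 1), ∑ l : Fin (d + 1), ∑ κ : Fin (d + 1),
        ((∑ r ∈ box (d + 1) L, lam * c * ν * (G l (v + quo L (toSite r + s)) * H κ v * T κ 0 s t l l' *
          K l' (v + quo L (toSite r + t)))) - c * ν * (G l (v + s) * H κ v * T κ 0 s t l l' * K l' (v + t)))
      = ∑ t ∈ B, ∑ s ∈ B, ∑ l' : Fin (d + 1), ∑ l : Fin (d + 1), ∑ κ : Fin (d + 1),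
          (c * ν * (H κ v * T κ 0 s t l l') *
            (G l v * (lam * (∑ r ∈ box (d + 1) L, rem2 (K l') (quo L (toSite r + t)) v) - rem2 (K l') t v) +
             K l' v * (lam * (∑ r ∈ box (d + 1) L, rem2 (G l) (quo L (toSite r + s)) v) - rem2 (G l) s v) +
             (lam * (∑ r ∈ box (d + 1) L, (G l (v + quo L (toSite r + s)) - G l v) *
                (K l' (v + quo L (toSite r + t)) - K l' v)) - (G l (v + s) - G l v) * (K l' (v + t) - K l' v))) +
          c * ν * (H κ v * T κ 0 s t l l') * (G l v * K l' v * (lam * (box (d + 1) L).card - 1))) :=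
        Finset.sum_congr rfl fun t ht => Finset.sum_congr rfl fun s hs => Finset.sum_congr rfl fun l' _ =>
          Finset.sum_congr rfl fun l _ => Finset.sum_congr rfl fun κ _ => hterm t ht s hs l' l κ
    _ = _ := by simp only [Finset.sum_add_distrib]; rw [hZ, add_zero]

end Bound

/-- [folklore] Five finite sums commute with a lattice `tsum` of summable families. -/
theorem tsum_sum5 (B : Finset (Fin (d + 1) → ℤ))
    {f : (Fin (d + 1) → ℤ) → (Fin (d + 1) → ℤ) → Fin (d + 1) → Fin (d + 1) → Fin (d + 1) → (Fin (d + 1) → ℤ) → ℝ}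
    (hf : ∀ t s l' l κ, Summable (f t s l' l κ)) :
    ∑' v, ∑ t ∈ B, ∑ s ∈ B, ∑ l' : Fin (d + 1), ∑ l : Fin (d + 1), ∑ κ : Fin (d + 1), f t s l' l κ v =
      ∑ t ∈ B, ∑ s ∈ B, ∑ l' : Fin (d + 1), ∑ l : Fin (d + 1), ∑ κ : Fin (d + 1), ∑' v, f t s l' l κ v := by
  rw [Summable.tsum_finsetSum (fun t _ => summable_sum fun s _ => summable_sum fun l' _ =>
        summable_sum fun l _ => summable_sum fun κ _ => hf t s l' l κ)]
  refine Finset.sum_congr rfl fun t _ => ?_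
  rw [Summable.tsum_finsetSum (fun s _ => summable_sum fun l' _ => summable_sum fun l _ =>
        summable_sum fun κ _ => hf t s l' l κ)]
  refine Finset.sum_congr rfl fun s _ => ?_
  rw [Summable.tsum_finsetSum (fun l' _ => summable_sum fun l _ => summable_sum fun κ _ => hf t s l' l κ)]
  refine Finset.sum_congr rfl fun l' _ => ?_
  rw [Summable.tsum_finsetSum (fun l _ => summable_sum fun κ _ => hf t s l' l κ)]
  refine Finset.sum_congr rfl fun l _ => ?_
  rw [Summable.tsum_finsetSum (fun κ _ => hf t s l' l κ)]

section Group

variable (N L : ℕ) [NeZero N] [NeZero L] (A : Fin (d + 1) → Fin (d + 1) → Fin (d + 1) → (Fin (d + 1) → ℤ) → ℝ)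
  (F : Fin (d + 1) → Fin (d + 1) → (Fin (d + 1) → ℤ) → ℝ)
  (W : Fin (d + 1) → (Fin (d + 1) → ℤ) → (Fin (d + 1) → ℤ) → Fin (d + 1) → Fin (d + 1) → ℝ)
  (off : (Fin (d + 1) → ℤ) → (Fin (d + 1) → ℤ) → (Fin (d + 1) → ℤ))
  (B : Finset (Fin (d + 1) → ℤ)) (a₁ a₂ a₃ : Fin (d + 1) → ℤ) {δ c lam CA αA βF CT : ℝ} {R : ℕ}

omit [NeZero L] in
/-- [folklore] Every family of a remainder group is a summable pairing. -/
theorem summable_group_term (hδ : 0 < δ) (hβF : 0 ≤ βF)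
    (hA : ∀ κ l l' v, |A κ l l' v| ≤ CA * Real.exp (-δ * (l1 (quo N v - a₁) + l1 (quo N v - a₂))))
    (hF' : ∀ l l' v j, |F l l' (v + Pi.single j 1) - F l l' v| ≤ βF * Real.exp (-δ * l1 (quo N v - a₃)))
    (t s : Fin (d + 1) → ℤ) (l' l κ : Fin (d + 1)) :
    Summable fun v => c * W κ s t l l' * A κ l l' v *
      (lam * (∑ r ∈ box (d + 1) L, rem2 (F l l') (quo L (toSite r + off s t)) v) - rem2 (F l l') (off s t) v) := by
  have hP := fun b => summable_pairing_rem2 N (A := A κ l l') (F := F l l') hδ hβF (hA κ l l') (hF' l l') b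
  have h := (((summable_sum fun r (_ : r ∈ box (d + 1) L) => hP (quo L (toSite r + off s t))).mul_left lam).sub
    (hP (off s t))).mul_left (c * W κ s t l l')
  refine h.congr fun v => ?_
  have e : ∑ r ∈ box (d + 1) L, A κ l l' v * rem2 (F l l') (quo L (toSite r + off s t)) v =
      A κ l l' v * ∑ r ∈ box (d + 1) L, rem2 (F l l') (quo L (toSite r + off s t)) v := by rw [Finset.mul_sum]
  rw [e]; ring

/-- [folklore] **A REMAINDER GROUP IS `O(R²/N²)` AFTER SUMMATION** (pairing lemma per family, `|off s t|₁ ≤ R`, carries no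
longer than offsets, `λ·#box = L`):
`|Σ'_v Σ c·W·A v·(λΣ_r rem2 F (carry) v − rem2 F (off) v)| ≤ |B|²(d+1)³·c·C_T·(L+1)·R·α_A·β_F·S₃`. -/
theorem abs_tsum_group_le (hδ : 0 < δ) (hc : 0 ≤ c) (hlam : 0 ≤ lam) (hlamL : lam * (box (d + 1) L).card = L)
    (hαA : 0 ≤ αA) (hβF : 0 ≤ βF)
    (hA : ∀ κ l l' v, |A κ l l' v| ≤ CA * Real.exp (-δ * (l1 (quo N v - a₁) + l1 (quo N v - a₂))))
    (hA' : ∀ κ l l' v b, LatticeForm.l1 b ≤ R →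
      |A κ l l' (v - b) - A κ l l' v| ≤ αA * Real.exp (-δ * (l1 (quo N v - a₁) + l1 (quo N v - a₂))))
    (hF' : ∀ l l' v j, |F l l' (v + Pi.single j 1) - F l l' v| ≤ βF * Real.exp (-δ * l1 (quo N v - a₃)))
    (hoff : ∀ s ∈ B, ∀ t ∈ B, LatticeForm.l1 (off s t) ≤ R) (hW : ∀ κ s t l l', |W κ s t l l'| ≤ CT) :
    |∑' v, ∑ t ∈ B, ∑ s ∈ B, ∑ l' : Fin (d + 1), ∑ l : Fin (d + 1), ∑ κ : Fin (d + 1),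
        c * W κ s t l l' * A κ l l' v *
          (lam * (∑ r ∈ box (d + 1) L, rem2 (F l l') (quo L (toSite r + off s t)) v) - rem2 (F l l') (off s t) v)| ≤
      (B.card : ℝ) ^ 2 * ((d : ℝ) + 1) ^ 3 * (c * CT * ((L : ℝ) + 1) * R * αA * βF *
        ∑' v, Real.exp (-δ * (l1 (quo N v - a₁) + l1 (quo N v - a₂) + l1 (quo N v - a₃)))) := by
  set S : ℝ := ∑' v, Real.exp (-δ * (l1 (quo N v - a₁) + l1 (quo N v - a₂) + l1 (quo N v - a₃))) with hS
  have hS0 : 0 ≤ S := tsum_nonneg fun _ => (Real.exp_pos _).le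
  have hCT : 0 ≤ CT := (abs_nonneg _).trans (hW 0 0 0 0 0)
  have hR : (0 : ℝ) ≤ R := by positivity
  have hP := fun κ l l' b (hb : LatticeForm.l1 b ≤ R) =>
    abs_tsum_pairing_rem2_le N (A := A κ l l') (F := F l l') hδ hαA hβF (hA κ l l') (hA' κ l l') (hF' l l') hb
  have hPs := fun κ l l' b => summable_pairing_rem2 N (A := A κ l l') (F := F l l') hδ hβF (hA κ l l') (hF' l l') b
  rw [tsum_sum5 B (fun t s l' l κ => summable_group_term N L A F W off a₁ a₂ a₃ hδ hβF hA hF' t s l' l κ)]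
  refine abs_sum5_le B fun t ht s hs l' l κ => ?_
  -- one family: constants out of the `tsum`, the two pairings bounded by the pairing lemma
  have hRb : ∀ b, LatticeForm.l1 b ≤ R → |∑' v, A κ l l' v * rem2 (F l l') b v| ≤ R * αA * βF * S := by
    intro b hb
    refine (hP κ l l' b hb).trans ?_
    have : (LatticeForm.l1 b : ℝ) ≤ R := by exact_mod_cast hb
    rw [← hS]; gcongr
  have e : ∑' v, c * W κ s t l l' * A κ l l' v *
      (lam * (∑ r ∈ box (d + 1) L, rem2 (F l l') (quo L (toSite r + off s t)) v) - rem2 (F l l') (off s t) v) =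
      c * W κ s t l l' * (lam * (∑ r ∈ box (d + 1) L, ∑' v, A κ l l' v * rem2 (F l l') (quo L (toSite r + off s t)) v) -
        ∑' v, A κ l l' v * rem2 (F l l') (off s t) v) := by
    rw [← Summable.tsum_finsetSum (fun r _ => hPs κ l l' _), ← tsum_mul_left,
      ← ((summable_sum fun r (_ : r ∈ box (d + 1) L) => hPs κ l l' (quo L (toSite r + off s t))).mul_left lam).tsum_sub
        (hPs κ l l' (off s t)), ← tsum_mul_left]
    refine tsum_congr fun v => ?_
    have e1 : ∑ r ∈ box (d + 1) L, A κ l l' v * rem2 (F l l') (quo L (toSite r + off s t)) v =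
        A κ l l' v * ∑ r ∈ box (d + 1) L, rem2 (F l l') (quo L (toSite r + off s t)) v := by rw [Finset.mul_sum]
    rw [e1]; ring
  rw [e, abs_mul, abs_mul, abs_of_nonneg hc]
  have h1 : |lam * (∑ r ∈ box (d + 1) L, ∑' v, A κ l l' v * rem2 (F l l') (quo L (toSite r + off s t)) v) -
      ∑' v, A κ l l' v * rem2 (F l l') (off s t) v| ≤ ((L : ℝ) + 1) * (R * αA * βF * S) := by
    refine (abs_sub _ _).trans ?_
    rw [abs_mul, abs_of_nonneg hlam, add_mul, one_mul]
    refine add_le_add ?_ (hRb _ (hoff s hs t ht))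
    calc lam * |∑ r ∈ box (d + 1) L, ∑' v, A κ l l' v * rem2 (F l l') (quo L (toSite r + off s t)) v|
        ≤ lam * ∑ r ∈ box (d + 1) L, R * αA * βF * S := by
          refine mul_le_mul_of_nonneg_left ((Finset.abs_sum_le_sum_abs _ _).trans (Finset.sum_le_sum fun r hr => ?_)) hlam
          exact hRb _ ((natl1_quo_toSite_add_le L hr _).trans (hoff s hs t ht))
      _ = (L : ℝ) * (R * αA * βF * S) := by rw [Finset.sum_const, nsmul_eq_mul, ← mul_assoc, hlamL]
  calc c * |W κ s t l l'| * |lam * (∑ r ∈ box (d + 1) L, ∑' v, A κ l l' v * rem2 (F l l') (quo L (toSite r + off s t)) v) -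
        ∑' v, A κ l l' v * rem2 (F l l') (off s t) v|
      ≤ c * CT * (((L : ℝ) + 1) * (R * αA * βF * S)) :=
        mul_le_mul (mul_le_mul_of_nonneg_left (hW κ s t l l') hc) h1 (abs_nonneg _) (mul_nonneg hc hCT)
    _ = _ := by ring

end Group

section Mixed

variable (N L : ℕ) [NeZero N] (G K H : Fin (d + 1) → (Fin (d + 1) → ℤ) → ℝ)
  (T : Fin (d + 1) → (Fin (d + 1) → ℤ) → (Fin (d + 1) → ℤ) → (Fin (d + 1) → ℤ) → Fin (d + 1) → Fin (d + 1) → ℝ)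
  (B : Finset (Fin (d + 1) → ℤ)) (x' z' u' : Fin (d + 1) → ℤ) {δ CG' CK' CH CT : ℝ} {R : ℕ}

/-- [folklore] THE MIXED GROUP, POINTWISE: two box steps, `O(R²/N²)`:
`|Σ c·(H v·T₀)·(λΣ_r dG(cs r)·dK(ct r) − dG s·dK t)| ≤ |B|²(d+1)³·c·C_T·C_H·(L+1)·R²·(C′_G/N)(C′_K/N)·e^{2δR}·(weight at v)`. -/
theorem abs_mixed_le {c lam : ℝ} (hδ : 0 ≤ δ) (hc : 0 ≤ c) (hlam : 0 ≤ lam) (hlamL : lam * (box (d + 1) L).card = L)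
    (hCG' : 0 ≤ CG') (hCK' : 0 ≤ CK')
    (hG' : ∀ l w j, |G l (w + Pi.single j 1) - G l w| ≤ CG' / N * Real.exp (-δ * l1 (quo N w - x')))
    (hK' : ∀ l y j, |K l (y + Pi.single j 1) - K l y| ≤ CK' / N * Real.exp (-δ * l1 (quo N y - z')))
    (hH : ∀ κ v, |H κ v| ≤ CH * Real.exp (-δ * l1 (quo N v - u')))
    (hB : ∀ s ∈ B, LatticeForm.l1 s ≤ R) (hT0 : ∀ κ v w y l l', |T κ v w y l l'| ≤ CT) (L0 : 0 < L)
    (v : Fin (d + 1) → ℤ) :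
    |∑ t ∈ B, ∑ s ∈ B, ∑ l' : Fin (d + 1), ∑ l : Fin (d + 1), ∑ κ : Fin (d + 1),
        c * (H κ v * T κ 0 s t l l') *
          (lam * (∑ r ∈ box (d + 1) L, (G l (v + quo L (toSite r + s)) - G l v) *
            (K l' (v + quo L (toSite r + t)) - K l' v)) - (G l (v + s) - G l v) * (K l' (v + t) - K l' v))| ≤
      ((B.card : ℝ) ^ 2 * ((d : ℝ) + 1) ^ 3 * (c * CT * CH * ((L : ℝ) + 1) * R ^ 2 * (CG' / N) * (CK' / N) *
        Real.exp (2 * δ * R))) * Real.exp (-δ * (l1 (quo N v - x') + l1 (quo N v - u') + l1 (quo N v - z'))) := by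
  haveI : NeZero L := ⟨L0.ne'⟩
  have hCT : 0 ≤ CT := (abs_nonneg _).trans (hT0 0 0 0 0 0 0)
  have hBR : ∀ s ∈ B, l1 s ≤ (R : ℝ) := fun s hs => l1_le_of_natl1_le (hB s hs)
  rw [mul_assoc (((B.card : ℝ) ^ 2 * ((d : ℝ) + 1) ^ 3))]
  refine abs_sum5_le B fun t ht s hs l' l κ => ?_
  set ωx : ℝ := Real.exp (-δ * l1 (quo N v - x')) with hωx
  set ωz : ℝ := Real.exp (-δ * l1 (quo N v - z')) with hωz
  set ωu : ℝ := Real.exp (-δ * l1 (quo N v - u')) with hωu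
  have hX : ∀ b, l1 b ≤ R → |G l (v + b) - G l v| ≤ R * (CG' / N) * Real.exp (δ * R) * ωx :=
    fun b hb => abs_boxstep_le N hδ hCG' (hG' l) v hb
  have hY : ∀ b, l1 b ≤ R → |K l' (v + b) - K l' v| ≤ R * (CK' / N) * Real.exp (δ * R) * ωz :=
    fun b hb => abs_boxstep_le N hδ hCK' (hK' l') v hb
  have hX0 : 0 ≤ R * (CG' / N) * Real.exp (δ * R) * ωx := (abs_nonneg _).trans (hX s (hBR s hs))
  have hprod : ∀ b b', l1 b ≤ R → l1 b' ≤ R → |(G l (v + b) - G l v) * (K l' (v + b') - K l' v)| ≤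
      (R * (CG' / N) * Real.exp (δ * R) * ωx) * (R * (CK' / N) * Real.exp (δ * R) * ωz) := by
    intro b b' hb hb'
    rw [abs_mul]; exact mul_le_mul (hX b hb) (hY b' hb') (abs_nonneg _) hX0
  have hmix : |lam * (∑ r ∈ box (d + 1) L, (G l (v + quo L (toSite r + s)) - G l v) *
      (K l' (v + quo L (toSite r + t)) - K l' v)) - (G l (v + s) - G l v) * (K l' (v + t) - K l' v)| ≤
      ((L : ℝ) + 1) * ((R * (CG' / N) * Real.exp (δ * R) * ωx) * (R * (CK' / N) * Real.exp (δ * R) * ωz)) := by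
    refine (abs_sub _ _).trans ?_
    rw [add_mul, one_mul, abs_mul, abs_of_nonneg hlam]
    refine add_le_add ?_ (hprod s t (hBR s hs) (hBR t ht))
    calc lam * |∑ r ∈ box (d + 1) L, (G l (v + quo L (toSite r + s)) - G l v) * (K l' (v + quo L (toSite r + t)) - K l' v)|
        ≤ lam * ∑ r ∈ box (d + 1) L, (R * (CG' / N) * Real.exp (δ * R) * ωx) * (R * (CK' / N) * Real.exp (δ * R) * ωz) := by
          refine mul_le_mul_of_nonneg_left ((Finset.abs_sum_le_sum_abs _ _).trans (Finset.sum_le_sum fun r hr => ?_)) hlam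
          exact hprod _ _ ((l1_quo_toSite_add_le L hr s).trans (hBR s hs)) ((l1_quo_toSite_add_le L hr t).trans (hBR t ht))
      _ = (L : ℝ) * ((R * (CG' / N) * Real.exp (δ * R) * ωx) * (R * (CK' / N) * Real.exp (δ * R) * ωz)) := by
          rw [Finset.sum_const, nsmul_eq_mul, ← mul_assoc, hlamL]
  have e2 := hH κ v
  have e3 : |T κ 0 s t l l'| ≤ CT := hT0 κ 0 s t l l'
  have hCH : 0 ≤ CH * ωu := (abs_nonneg _).trans e2
  rw [abs_mul, abs_mul, abs_of_nonneg hc, abs_mul]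
  calc c * (|H κ v| * |T κ 0 s t l l'|) * |lam * (∑ r ∈ box (d + 1) L, (G l (v + quo L (toSite r + s)) - G l v) *
        (K l' (v + quo L (toSite r + t)) - K l' v)) - (G l (v + s) - G l v) * (K l' (v + t) - K l' v)|
      ≤ c * (CH * ωu * CT) * (((L : ℝ) + 1) * ((R * (CG' / N) * Real.exp (δ * R) * ωx) *
          (R * (CK' / N) * Real.exp (δ * R) * ωz))) :=
        mul_le_mul (mul_le_mul_of_nonneg_left (mul_le_mul e2 e3 (abs_nonneg _) hCH) hc) hmix (abs_nonneg _)
          (mul_nonneg hc (mul_nonneg hCH hCT))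
    _ = _ := by
        have hexp : Real.exp (δ * R) * Real.exp (δ * R) = Real.exp (2 * δ * R) := by rw [← Real.exp_add]; ring_nf
        rw [hωx, hωz, hωu, show -δ * (l1 (quo N v - x') + l1 (quo N v - u') + l1 (quo N v - z')) =
          -δ * l1 (quo N v - x') + -δ * l1 (quo N v - u') + -δ * l1 (quo N v - z') by ring, Real.exp_add, Real.exp_add,
          ← hexp]
        ring

end Mixed

end Summit.QuantumFields.BalabanUV.Beta.GAN24.TaylorTrilinearTransport

end
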